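import Literature.AlgebraicGeometry.Frobenioids.Thm49CompatAssembly
import Literature.AlgebraicGeometry.Frobenioids.Thm49PerfectionDescent
import Literature.AlgebraicGeometry.Frobenioids.Thm49IsotropicWLOG
import Literature.AlgebraicGeometry.Frobenioids.Thm42SubAssemblyIGeneral
import Literature.AlgebraicGeometry.Frobenioids.Cor412OfFSMType
import Literature.AlgebraicGeometry.Frobenioids.BaseCategoryTheoreticityProofs
import Literature.AlgebraicGeometry.Frobenioids.PerfectionRational
import Literature.AlgebraicGeometry.Frobenioids.PerfectionIsFrobenioid
import Literature.AlgebraicGeometry.Frobenioids.IsotropificationRational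
import Literature.AlgebraicGeometry.Frobenioids.Thm49AssemblyPieces
import Literature.AlgebraicGeometry.Frobenioids.PerfectionSquareFSMFF2024
import Literature.AlgebraicGeometry.Frobenioids.EquivalencePreStepsQuasiIsotropicFSMFF2024
import Literature.AlgebraicGeometry.Frobenioids.Thm42AssemblyPerfectAsPrinted
import Literature.AlgebraicGeometry.Frobenioids.PerfectionStandardTypes
import Literature.AlgebraicGeometry.Frobenioids.PerfectionIsotropic
import HarnessLib

/-!
# [FrdI] Theorem 4.9 AS TYPED over the author's REVISED (2024) FSMFF bases — twin of `Thm49Assembly.lean`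

Mochizuki, *The geometry of Frobenioids I: the general theory*, Kyushu J. Math. **62** (2008) 293–400,
§4, Theorem 4.9 pp. 88–90 [cite: MochizukiFrdI2008, Thm. 4.9 p.88]; *Comments* (2024) (28) p. 3 — the revised
definition of "FSMFF type" [cite: MochizukiFrdIComments2024, (28) p.3].

PROOF-ONLY twin (seat abc-iut-w4-d109) of `FrdI.T49.thm49_ofFunctor_of_isOfFSMType` (`Thm49Assembly.lean`) with
the base hypothesis WEAKENED from FSM-type to the author's 2024-revised FSMFF-type (`IsOfFSMFFType2024`; FSM ⇒
FSMFF-2024, `IsOfFSMType.isOfFSMFFType2024`) — the base hypothesis under which the cell's Thm. 3.4 (ii)/(iii)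
closers of seat abc-iut-L1-t11 (`FrdI.isPreStep_map_of_quasiIsotropic_of_isOfFSMFFType2024`,
`FrdI.isFrobeniusCompatible_of_isOfFSMFFType2024`) and the Cor. 4.11 (ii) apex hold. Differences in the route:
Thm. 3.4 (iii)/(ii) for `Ψ^istr` by the FSMFF-2024 closers; the setting of the proof at the perfections
`((C_i^istr)^pf)` from the PRINTED hypotheses at perfect type (`PreFrobenioidData.setting_of_perfectType_asPrinted`,
seat abc-iut-w4-d093 — no base hypothesis beyond standard type there), with "`(C^istr)^pf` of standard type" by
Prop. 5.5 (iii) (`FrdI.Prop55Sub.prop55iii_pf_standard_of_not_groupLike`, seats abc-iut-w5-d042 / L1-d9). The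
rest is `Thm49Assembly.lean` verbatim: group-like case trivial; Rmk. 4.5.1 + Prop. 5.5 (iii) rationality;
`exists_thm49_compat_perfect_primarySupp` (seat abc-iut-w4-d099); descents `nonempty_divisorMonoidIsoOver_of_perfection`
/ `nonempty_divisorMonoidIsoOver_of_isotropic`.

Result `FrdI.T49.thm49_ofFunctor_of_isOfFSMFFType2024 … : (ofFunctor Φ₁ F₁).Thm49 (ofFunctor Φ₂ F₂) Ψ R₁ R₂` over
{Frobenioids, FSMFF-2024 bases, `Φ_i` perf-factorial, `C₁` of rational type at THE birationalization / support}.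
No new definitions; no statement of the paper is strengthened; nothing here bears on [IUTchIII] Cor. 3.12.
-/


namespace Literature.AlgebraicGeometry.Frobenioids

namespace FrdI.T49

open CategoryTheory Opposite PreFrobenioidData

universe w v v' u u'

variable {D₁ : Type u} [Category.{v} D₁] {Φ₁ : D₁ᵒᵖ ⥤ CommMonCat.{w}} {C₁ : Type u'} [Category.{v'} C₁]
  {D₂ : Type u} [Category.{v} D₂] {Φ₂ : D₂ᵒᵖ ⥤ CommMonCat.{w}} {C₂ : Type u'} [Category.{v'} C₂]
  {F₁ : C₁ ⥤ ElemFrobenioid Φ₁} {F₂ : C₂ ⥤ ElemFrobenioid Φ₂}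

/-- **[FrdI] Theorem 4.9 AS TYPED (`PreFrobenioidData.Thm49` at `ofFunctor`) over FSMFF-type bases in the
author's revised (2024) sense**, for Frobenioids `C_i → F_{Φ_i}` with perf-factorial `Φ_i`, with `C₁` of rational type at THE
birationalization / support (`hrat₁`): for `C_i` of rationally standard type there is an isomorphism of
functors `Ψ^Φ : Φ₁ ⥲ Φ₂` lying over `Ψ`. Proof = the printed one: isotropifications (Thm. 3.4 (i)) and their
non-group-like objects, perfections (Thm. 3.4 (iii); Prop. 3.2 (iii) `Perfection.isFrobenioid`), rationality
of the isotropification (Rmk. 4.5.1, `isRational_istr_of`) and of the perfection (Prop. 5.5 (iii),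
`Perfection.isRational_perfection_of`), Thm. 4.9 at the perfect-isotropic level (rows T49-L02/L05/L06/L07/L08′,
`exists_thm49_compat_perfect_primarySupp`), descent along `Φ ↪ Φ^pf` (`nonempty_divisorMonoidIsoOver_of_perfection`),
extension along isotropic hulls (row T49-L01); the group-like case is the trivial isomorphism.
[cite: MochizukiFrdI2008, Thm. 4.9 p.88] [cite: MochizukiFrdIComments2024, (28) p.3] -/
theorem thm49_ofFunctor_of_isOfFSMFFType2024 (hF₁ : PreFrobenioid.IsFrobenioid F₁)
    (hF₂ : PreFrobenioid.IsFrobenioid F₂) (hD₁ : IsOfFSMFFType2024 D₁) (hD₂ : IsOfFSMFFType2024 D₂)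
    (hpf₁ : Objectwise (fun M _ => IsPerfFactorial M) Φ₁) (hpf₂ : Objectwise (fun M _ => IsPerfFactorial M) Φ₂)
    (hrat₁ : ∀ A : C₁, PreFrobenioidData.IsRational
      (PreFrobenioid.biratData hF₁ (PreFrobenioid.hasBiratSquares_of_isFrobenioid hF₁))
      (S := ofFunctor Φ₁ F₁) (fun a 𝔭 => PrimarySupp a 𝔭) A)
    (Ψ : C₁ ≌ C₂) (R₁ : (ofFunctor Φ₁ F₁).RSParams) (R₂ : (ofFunctor Φ₂ F₂).RSParams) :
    (ofFunctor Φ₁ F₁).Thm49 (ofFunctor Φ₂ F₂) Ψ R₁ R₂ := by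
  intro hR₁ hR₂
  have hs₁ := hR₁.standard
  have hs₂ := hR₂.standard
  have hP₁ := hF₁.isPreFrobenioid
  have hP₂ := hF₂.isPreFrobenioid
  have hq₁ := hs₁.quasiIsotropic
  have hq₂ := hs₂.quasiIsotropic
  -- "Theorem 4.9 is vacuous if `C₁`, `C₂` are of group-like type": the trivial isomorphism
  by_cases hg₁ : (ofFunctor Φ₁ F₁).IsOfGroupLikeType
  · exact nonempty_divisorMonoidIsoOver_of_isOfGroupLikeType F₁ F₂ Ψ hg₁
      ⟨fun B => (ofFunctor_isGroupLikeObj F₂ B).2 (FrdI.isGroupLikeObj_of_isBaseIso hP₂ (Ψ.counitIso.app B).hom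
        (FrdI.isGroupLikeObj_map_of_quasiIsotropic_of_isOfFSMFFType2024 hF₁ hF₂ hq₁ hq₂ hD₁ hD₂ Ψ
          ((ofFunctor_isGroupLikeObj F₁ _).1 (hg₁.obj _))))⟩
  -- non-group-like objects `N₁`, `Ψ N₁`
  obtain ⟨N₁, hN₁⟩ : ∃ A : C₁, ¬ PreFrobenioid.IsGroupLikeObj F₁ A := by
    by_contra h
    exact hg₁ ⟨fun A => (ofFunctor_isGroupLikeObj F₁ A).2 (not_exists_not.mp h A)⟩
  have hN₂ : ¬ PreFrobenioid.IsGroupLikeObj F₂ (Ψ.functor.obj N₁) := fun h =>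
    hN₁ (FrdI.isGroupLikeObj_of_isBaseIso' hP₁ (Ψ.unitIso.app N₁).hom
      (PreFrobenioid.isBaseIso_of_isIso F₁ _)
      (FrdI.isGroupLikeObj_map_of_quasiIsotropic_of_isOfFSMFFType2024 hF₂ hF₁ hq₂ hq₁ hD₂ hD₁ Ψ.symm h))
  -- (1) the isotropifications `C_i^istr` and the restriction `Ψ^istr` (Thm. 3.4 (i), Rmk. 4.5.1)
  haveI : (PreFrobenioid.isotropicObjects F₂).IsClosedUnderIsomorphisms :=
    ⟨fun e hX => PreFrobenioid.IsIsotropic.of_iso hP₂ e.symm hX⟩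
  have hinvImg := FrdI.isotropicObjects_inverseImage hF₁ hq₁ hq₂ Ψ
  let Ψi : PreFrobenioid.Istr F₁ ≌ PreFrobenioid.Istr F₂ := Ψ.congrFullSubcategory hinvImg
  have hI₁ := PreFrobenioid.isFrobenioid_istr hF₁
  have hI₂ := PreFrobenioid.isFrobenioid_istr hF₂
  have hsI₁ := PreFrobenioid.isOfStandardType_istr hF₁ hs₁
  have hsI₂ := PreFrobenioid.isOfStandardType_istr hF₂ hs₂
  have hNI₁ := not_isGroupLikeObj_hullIstr hF₁ hN₁
  have hNI₂ := not_isGroupLikeObj_hullIstr hF₂ hN₂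
  -- Thm. 3.4 (iii) for `Ψ^istr`: compatible with arrows of Frobenius type; Thm. 3.4 (ii): `(Ψ^istr)⁻¹`
  -- preserves pre-steps
  have hΨi : PreFrobenioid.IsFrobeniusCompatible (PreFrobenioid.istrFunctor F₁)
      (PreFrobenioid.istrFunctor F₂) Ψi.functor :=
    FrdI.isFrobeniusCompatible_of_isOfFSMFFType2024 hI₁ hI₂ hsI₁.quasiIsotropic hsI₂.quasiIsotropic hD₁ hD₂
      hsI₁.nonDilating hsI₂.nonDilating Ψi ⟨_, hNI₁⟩ ⟨_, hNI₂⟩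
  have hinvI : ∀ ⦃X Y : PreFrobenioid.Istr F₂⦄ (g : X ⟶ Y),
      PreFrobenioid.IsPreStep (PreFrobenioid.istrFunctor F₂) g →
        PreFrobenioid.IsPreStep (PreFrobenioid.istrFunctor F₁) (Ψi.inverse.map g) :=
    fun X Y g hg => FrdI.isPreStep_map_of_quasiIsotropic_of_isOfFSMFFType2024 hI₂ hI₁ hsI₂.quasiIsotropic
      hsI₁.quasiIsotropic hD₂ hD₁ Ψi.symm hg
  -- (2) the perfections `(C_i^istr)^pf`: Frobenioids (Prop. 3.2 (iii)), of standard type (Prop. 5.5 (iii)),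
  -- perfect and isotropic type, not group-like; the setting of the proof there from the PRINTED hypotheses
  have hisoI₁ := FrdI.T42.isFrobeniusIsotropic_of_isOfIsotropicType hI₁ PreFrobenioid.isOfIsotropicType_istr
  have hisoI₂ := FrdI.T42.isFrobeniusIsotropic_of_isOfIsotropicType hI₂ PreFrobenioid.isOfIsotropicType_istr
  have hPf₁ := PreFrobenioid.Perfection.isFrobenioid hI₁ hisoI₁
  have hPf₂ := PreFrobenioid.Perfection.isFrobenioid hI₂ hisoI₂
  have hnormI₁ : PreFrobenioid.IsOfType (PreFrobenioid.IsFrobeniusNormalized (PreFrobenioid.istrFunctor F₁)) :=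
    fun X => hsI₁.frobeniusNormalized.obj X
  have hnormI₂ : PreFrobenioid.IsOfType (PreFrobenioid.IsFrobeniusNormalized (PreFrobenioid.istrFunctor F₂)) :=
    fun X => hsI₂.frobeniusNormalized.obj X
  have hsP₁ := FrdI.Prop55Sub.prop55iii_pf_standard_of_not_groupLike hI₁ hPf₁ (fun h => hNI₁ (h _)) hisoI₁
    hnormI₁ hsI₁
  have hsP₂ := FrdI.Prop55Sub.prop55iii_pf_standard_of_not_groupLike hI₂ hPf₂ (fun h => hNI₂ (h _)) hisoI₂
    hnormI₂ hsI₂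
  have hT : Thm42Setting (PreFrobenioid.Perfection.ops hI₁) (PreFrobenioid.Perfection.ops hI₂) :=
    ⟨⟨hsP₁, hsP₂⟩, ⟨PreFrobenioid.Perfection.isOfIsotropicType_perfection hI₁ hisoI₁,
      PreFrobenioid.Perfection.isOfIsotropicType_perfection hI₂ hisoI₂⟩,
      ⟨fun h => hNI₁ ((PreFrobenioid.Perfection.isGroupLikeObj_ops_iff _).1
          (h.obj ((PreFrobenioid.Perfection.toPf hI₁).obj (PreFrobenioid.hullIstr hF₁ N₁)))),
        fun h => hNI₂ ((PreFrobenioid.Perfection.isGroupLikeObj_ops_iff _).1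
          (h.obj ((PreFrobenioid.Perfection.toPf hI₂).obj (PreFrobenioid.hullIstr hF₂ (Ψ.functor.obj N₁)))))⟩⟩
  haveI := PreFrobenioid.Perfection.map_isEquivalence (hF₁ := hI₁) (hF₂ := hI₂) Ψi hΨi
  have S := PreFrobenioidData.setting_of_perfectType_asPrinted
    (PreFrobenioid.Perfection.map (hF₁ := hI₁) (hF₂ := hI₂) hΨi).asEquivalence hPf₁ hPf₂
    ((ofFunctor_isOfPerfectType (PreFrobenioid.Perfection.ops hI₁).toFunctor).1
      (PreFrobenioid.Perfection.isOfPerfectType_perfection hI₁ hisoI₁))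
    ((ofFunctor_isOfPerfectType (PreFrobenioid.Perfection.ops hI₂).toFunctor).1
      (PreFrobenioid.Perfection.isOfPerfectType_perfection hI₂ hisoI₂))
    (fun X => PerfectionIsPerfFactorial_holds (hpf₁ X)) (fun X => PerfectionIsPerfFactorial_holds (hpf₂ X)) hT
  have hndp₂ : IsNonDilatingOn (PreFrobenioid.Perfection.ops hI₂).monFunctor :=
    FrdI.isNonDilatingOn_of_ofFunctor (F := (PreFrobenioid.Perfection.ops hI₂).toFunctor)
      (PreFrobenioid.Perfection.isNonDilatingOn_ops hI₂ hsI₂.nonDilating)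
  -- Rmk. 4.5.1: `C₁^istr` is of rational type; Prop. 5.5 (iii): so is `(C₁^istr)^pf`
  have hratI : ∀ A : PreFrobenioid.Istr F₁, PreFrobenioidData.IsRational
      (PreFrobenioid.biratData hI₁ (PreFrobenioid.hasBiratSquares_of_isFrobenioid hI₁))
      (S := ofFunctor Φ₁ (PreFrobenioid.istrFunctor F₁)) (fun a 𝔭 => PrimarySupp a 𝔭) A :=
    fun A => PreFrobenioid.isRational_istr_of hF₁ hrat₁ A
  have hratP : ∀ ⦃X : PreFrobenioid.Perfection hI₁⦄,
      PreFrobenioid.IsUniversallyDivFrobeniusTrivial (PreFrobenioid.Perfection.ops hI₁).toFunctor X →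
        PreFrobenioidData.IsRational (PreFrobenioid.biratData S.isFrobenioid₁
          (PreFrobenioid.hasBiratSquares_of_isFrobenioid S.isFrobenioid₁))
          (S := ofFunctor _ (PreFrobenioid.Perfection.ops hI₁).toFunctor) (fun a 𝔭 => PrimarySupp a 𝔭) X :=
    fun X _ => PreFrobenioid.Perfection.isRational_perfection_of hI₁ hPf₁ hratI X
  -- (3) Thm. 4.9 at the perfect-isotropic level (rows T49-L02/L05/L06/L07/L08′ with `Ψ^Prime`)
  obtain ⟨E', -, -, hE', -⟩ := exists_thm49_compat_perfect_primarySupp S hndp₂ hratP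
  -- (4) descent along `Φ_i ↪ Φ_i^pf` to the isotropifications
  obtain ⟨EI⟩ := nonempty_divisorMonoidIsoOver_of_perfection hI₁ hI₂ Ψi hΨi hinvI E'
    (fun X Y f hf => hE' f hf)
  -- (5) extension along isotropic hulls (row T49-L01)
  exact nonempty_divisorMonoidIsoOver_of_isotropic F₁ F₂ Ψ hF₁ hF₂
    (fun A hA => FrdI.isIsotropic_map hq₁ hq₂ Ψ hA)
    (fun A B h hh => FrdI.isIsotropicHull_map hF₁ hF₂ hq₁ hq₂ Ψ hh)
    (fun A hA => EI.iso ⟨A, hA⟩)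
    (fun A B hA hB φ x =>
      EI.natural (A := (⟨A, hA⟩ : PreFrobenioid.Istr F₁)) (B := ⟨B, hB⟩) (ObjectProperty.homMk φ) x)

end FrdI.T49

end Literature.AlgebraicGeometry.Frobenioids
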